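/-
Copyright (c) 2026 the pub-hodgecm-mathlib formalisation cell (harness21).  Prover seat hodgecm-mathlib-K2E5-p16 (g7), Track B «K2-LIT»,
#184♮ = hLiu418 = `stmt-HodgeConjecture-24832`; S2-asm road (γ) packaging, FRAME BLOCK FILE 4 (K2Liu-p05 (g6) desk 15:14:39Z ∕ closing table b71f9433d90220a3:
«`ιw hιfr` = general-`g` chart (F2), `hfr2` = p16 column»): the TUBE CHART `ι_w : M(ℂ) → archLocal w` (`P ↦` the element with matrix `reindex e₂ (T_w⁻¹ P T_w)` on
`U(J)`, `1` off it) matching the reading frames at the compact points, and the IWASAWA DECOMPOSITION RELATIVE TO THE FRAME (`hfr2`).  THEOREMS ONLY (no `def`,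
no `instance`, no notation, no `sorry`).
-/
import Summits.HodgeConjecture.HodgeConjecture.Theorems.K2LiuArchReadingFrame       -- ★ FILE 2: `exists_frameHom`, the reading frames' matrix formula
import Summits.HodgeConjecture.HodgeConjecture.Theorems.K2LiuArchSliceSiegel         -- ★ p05: `isSiegelDelta_archPiEquivCM_symm_mulSingle_iff`
import Summits.HodgeConjecture.HodgeConjecture.Theorems.K2LiuHermitianTubeAction      -- ★ H1-C: `exists_transl_levi_mul_stabilizer` (`U(J) = P·Stab(i1)`)
import Summits.HodgeConjecture.HodgeConjecture.Theorems.K2LiuU22ShilovCoordinate      -- ★ PART A: `cayley_diag_one_eq`, `kU_mem_UJ`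
import HarnessLib

/-!
# Crux `HLiu418`, Road (γ) frame block FILE 4: the tube chart `ι_w` and the Iwasawa decomposition relative to the reading frame (`hfr2`)

Cell `hodgecm-mathlib`, crux item hLiu418 = `stmt-HodgeConjecture-24832` (helper lane `--supports`, count-neutral).

* §1 (ring) **`siegel_of_toBlocks₂₁_eq_zero`** — the CONVERSE parabolic transport: for block letters `T = (D D; C₀ −C₀)`, `T⁻¹ = (P₀ −P₁; P₀ P₁)` (no relation needed) and any
  tube-Siegel `P` (`P₂₁ = 0`), `g := T⁻¹ P T` satisfies `g₁₁ + g₁₂ = g₂₁ + g₂₂` (`= 2P₀P₁₁D`), i.e. `IsSiegelM`;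
* §2 (generic frame, as ★ FILE 2 §1) **`exists_frameChart`** — `∃ ι : M → U` with matrix `reindex e₂ (T⁻¹ P T)` on `U(J)` and `ι (PQ) = ι P · ι Q` there (`1` off `U(J)`);
* §3 (CM instance) **`exists_readingChart`** — for the ★ FILE 2 reading frames `fr` (matrix formula `hfrM`): `∃ ι : ∀ w, M(ℂ) → archLocal w` with
  (hιfr) `ι_w (k_u) = fr_w u` (`k_u = κ(1,u)`, ★ `cayley_diag_one_eq`), the matrix formula and multiplicativity on `U(J)`, and
  (**hfr2**) `∀ w g, ∃ p, IsSiegelDelta (archPiEquivCM⁻¹ (δ_w p)) ∧ ∃ u : U(n), g = p · fr_w u` — tube Iwasawa ★ `exists_transl_levi_mul_stabilizer` + ★ `exists_kappa_eq_of_stab`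
  (`s = κ(a,b) = κ(a,a)·κ(1, aᴴb)`, ★ `kappa_mul`∕`kappa_self`) + §1 + ★ `isSiegelDelta_archPiEquivCM_symm_mulSingle_iff`.
These are the `ιw hιfr hfr2` (and, with `Kw w := range (fr w)`, `hk2`) binders of ★ `K2LiuArchSWSpanningInstance.archSWRegionSpanning_of_readings_on` (K2Liu-p05 (g6)).
References: [Shimura1997, §§5–6 (Case UT), §6.4–6.5]; [GelbartRogawski1991, §3.1]; [BorelJacquet1979, §4.1].
HONEST LABEL: HC_CM is proved only modulo the 7 printed citations (2 remaining named inputs: hLiu418 = stmt-HodgeConjecture-24832,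
h413 = stmt-HodgeConjecture-24833) until rung 0 closes; count-neutral helper, closes no socket.
-/

set_option autoImplicit false
set_option linter.dupNamespace false

noncomputable section

namespace Summit.HodgeConjecture.HodgeConjecture.Cruxes.HLiu418.K2LiuArchReadingChart

open Matrix Complex NumberField
open scoped MatrixGroups ComplexConjugate Classical
open Literature.NumberTheory.Automorphic Literature.NumberTheory.Automorphic.UnitaryGroup
open Literature.NumberTheory.GelbartRogawski1991 Literature.NumberTheory.GelbartRogawski1991.GRConstruction
open Literature.NumberTheory.ModularForms.SiegelUpperHalfSpace (moeb)
open K2LiuHermitianTubeCocycle K2LiuHermitianTubeFrame K2LiuHermitianTubeFrameArch K2LiuHermitianTubeFrameArchInv K2LiuHermitianTubeFrameSign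
open K2LiuArchFrameBridge K2LiuHermitianTubeAction K2LiuU22ShilovCoordinate K2LiuArchReadingFrame K2LiuArchSliceSiegel

/-! ## §1 The converse parabolic transport -/

/-- **`P₂₁ = 0 ⇒ T⁻¹ P T ∈ P_Δ`** for the block letters `T = (D D; C₀ −C₀)`, `T⁻¹ = (P₀ −P₁; P₀ P₁)` (no relation between the letters is needed):
`g := T⁻¹ P T` has `g₁₁ + g₁₂ = g₂₁ + g₂₂`. [cite: Shimura1997, §6.4] [cite: GelbartRogawski1991, §3.1] -/
theorem siegel_of_toBlocks₂₁_eq_zero {l : Type*} [Fintype l] [DecidableEq l] (D C₀ P₀ P₁ : Matrix l l ℂ) {P : Matrix (l ⊕ l) (l ⊕ l) ℂ}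
    (hP : P.toBlocks₂₁ = 0) :
    (fromBlocks P₀ (-P₁) P₀ P₁ * P * fromBlocks D D C₀ (-C₀)).toBlocks₁₁ + (fromBlocks P₀ (-P₁) P₀ P₁ * P * fromBlocks D D C₀ (-C₀)).toBlocks₁₂ =
      (fromBlocks P₀ (-P₁) P₀ P₁ * P * fromBlocks D D C₀ (-C₀)).toBlocks₂₁ + (fromBlocks P₀ (-P₁) P₀ P₁ * P * fromBlocks D D C₀ (-C₀)).toBlocks₂₂ := by
  have hPe : P = fromBlocks P.toBlocks₁₁ P.toBlocks₁₂ 0 P.toBlocks₂₂ := by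
    conv_lhs => rw [← fromBlocks_toBlocks P]
    rw [hP]
  rw [hPe, fromBlocks_multiply, fromBlocks_multiply]
  simp only [toBlocks_fromBlocks₁₁, toBlocks_fromBlocks₁₂, toBlocks_fromBlocks₂₁, toBlocks_fromBlocks₂₂]
  noncomm_ring

/-! ## §2 Generic frame: the chart `P ↦ ι P` -/

section Generic

variable {n : ℕ} {T Tinv : Matrix (Fin n ⊕ Fin n) (Fin n ⊕ Fin n) ℂ}

/-- **THE FRAME CHART**: `∃ ι : M(ℂ) → U` with matrix `reindex e₂ (T⁻¹ P T)` for `P ∈ U(J)` and `ι (PQ) = ι P · ι Q` on `U(J)` (the element is built with inverse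
`reindex e₂ (T⁻¹ (−J Pᴴ J) T)`, ★ `neg_J_conjTranspose_J_mul`; off `U(J)` the chart is `1`). [cite: Shimura1997, §§5–6] [cite: BorelJacquet1979, §4.1] -/
theorem exists_frameChart (h1 : T * Tinv = 1) (h2 : Tinv * T = 1) {H : Matrix (Fin n ⊕ Fin n) (Fin n ⊕ Fin n) ℂ} (hT : Tᴴ * (I • Matrix.J (Fin n) ℂ) * T = H)
    (U : Subgroup (GL (Fin (n + n)) ℂ))
    (hU : ∀ g : GL (Fin (n + n)) ℂ, g ∈ U ↔
      (Matrix.reindex (e₂ (n := n)).symm (e₂ (n := n)).symm (g : Matrix (Fin (n + n)) (Fin (n + n)) ℂ))ᴴ * H *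
        Matrix.reindex (e₂ (n := n)).symm (e₂ (n := n)).symm (g : Matrix (Fin (n + n)) (Fin (n + n)) ℂ) = H) :
    ∃ ι : Matrix (Fin n ⊕ Fin n) (Fin n ⊕ Fin n) ℂ → U,
      (∀ P, Pᴴ * Matrix.J (Fin n) ℂ * P = Matrix.J (Fin n) ℂ →
        (((ι P : U) : GL (Fin (n + n)) ℂ) : Matrix (Fin (n + n)) (Fin (n + n)) ℂ) = Matrix.reindex (e₂ (n := n)) (e₂ (n := n)) (Tinv * P * T)) ∧
      (∀ P Q, Pᴴ * Matrix.J (Fin n) ℂ * P = Matrix.J (Fin n) ℂ → Qᴴ * Matrix.J (Fin n) ℂ * Q = Matrix.J (Fin n) ℂ → ι (P * Q) = ι P * ι Q) := by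
  -- the `GL`-element attached to `P ∈ U(J)` (as in ★ `exists_tubeFrame_arch₂`'s surjectivity clause)
  have hGL : ∀ P, Pᴴ * Matrix.J (Fin n) ℂ * P = Matrix.J (Fin n) ℂ →
      Matrix.reindex (e₂ (n := n)) (e₂ (n := n)) (Tinv * P * T) * Matrix.reindex (e₂ (n := n)) (e₂ (n := n)) (Tinv * -(Matrix.J (Fin n) ℂ * Pᴴ * Matrix.J (Fin n) ℂ) * T) = 1 ∧
      Matrix.reindex (e₂ (n := n)) (e₂ (n := n)) (Tinv * -(Matrix.J (Fin n) ℂ * Pᴴ * Matrix.J (Fin n) ℂ) * T) * Matrix.reindex (e₂ (n := n)) (e₂ (n := n)) (Tinv * P * T) = 1 := by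
    intro P hP
    constructor
    · rw [reindex_apply, reindex_apply, submatrix_mul_equiv, show Tinv * P * T * (Tinv * -(Matrix.J (Fin n) ℂ * Pᴴ * Matrix.J (Fin n) ℂ) * T) =
        Tinv * (P * ((T * Tinv) * -(Matrix.J (Fin n) ℂ * Pᴴ * Matrix.J (Fin n) ℂ))) * T by simp only [Matrix.mul_assoc], h1, Matrix.one_mul,
        mul_neg_J_conjTranspose_J hP, Matrix.mul_one, h2, submatrix_one_equiv]
    · rw [reindex_apply, reindex_apply, submatrix_mul_equiv, show Tinv * -(Matrix.J (Fin n) ℂ * Pᴴ * Matrix.J (Fin n) ℂ) * T * (Tinv * P * T) =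
        Tinv * (-(Matrix.J (Fin n) ℂ * Pᴴ * Matrix.J (Fin n) ℂ) * ((T * Tinv) * P)) * T by simp only [Matrix.mul_assoc], h1, Matrix.one_mul,
        neg_J_conjTranspose_J_mul hP, Matrix.mul_one, h2, submatrix_one_equiv]
  have hmem : ∀ P (hP : Pᴴ * Matrix.J (Fin n) ℂ * P = Matrix.J (Fin n) ℂ),
      (⟨_, _, (hGL P hP).1, (hGL P hP).2⟩ : GL (Fin (n + n)) ℂ) ∈ U := by
    intro P hP
    rw [hU]
    show (Matrix.reindex (e₂ (n := n)).symm (e₂ (n := n)).symm (Matrix.reindex (e₂ (n := n)) (e₂ (n := n)) (Tinv * P * T)))ᴴ * H * _ = H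
    rw [reindex_symm_reindex]
    exact inv_conj_preserves hT h1 h2 hP
  refine ⟨fun P => if hP : Pᴴ * Matrix.J (Fin n) ℂ * P = Matrix.J (Fin n) ℂ then ⟨_, hmem P hP⟩ else 1,
    fun P hP => by dsimp only; rw [dif_pos hP], fun P Q hP hQ => ?_⟩
  dsimp only
  rw [dif_pos (mul_mem_UJ hP hQ), dif_pos hP, dif_pos hQ]
  apply Subtype.ext; apply Units.ext
  show Matrix.reindex (e₂ (n := n)) (e₂ (n := n)) (Tinv * (P * Q) * T) =
    Matrix.reindex (e₂ (n := n)) (e₂ (n := n)) (Tinv * P * T) * Matrix.reindex (e₂ (n := n)) (e₂ (n := n)) (Tinv * Q * T)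
  rw [reindex_apply, reindex_apply, reindex_apply, submatrix_mul_equiv, show Tinv * P * T * (Tinv * Q * T) = Tinv * (P * ((T * Tinv) * Q)) * T by
    simp only [Matrix.mul_assoc], h1, Matrix.one_mul, Matrix.mul_assoc]

end Generic

/-! ## §3 The CM instance: the reading charts and the Iwasawa decomposition relative to the reading frames -/

section CM

variable (L : Type) [Field L] [NumberField L] [IsCMField L] {N M n : ℕ} (e : Fin N × Fin M ≃ Fin n)
  (dV : Fin N → L) (hdV : ∀ i, IsCMField.complexConj L (dV i) = dV i)
  (dW : Fin M → L) (hdW : ∀ i, IsCMField.complexConj L (dW i) = dW i)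

/-- unitarity bookkeeping: `aᴴ a = 1`, `bᴴ b = 1` ⇒ `a aᴴ = 1` and `(aᴴ b)ᴴ (aᴴ b) = 1`. [folklore] -/
theorem conjTranspose_mul_aux {l : Type*} [Fintype l] [DecidableEq l] {a b : Matrix l l ℂ} (ha : aᴴ * a = 1) (hb : bᴴ * b = 1) :
    a * aᴴ = 1 ∧ (aᴴ * b)ᴴ * (aᴴ * b) = 1 := by
  have ha' : a * aᴴ = 1 := mul_eq_one_comm.1 ha
  refine ⟨ha', ?_⟩
  rw [conjTranspose_mul, conjTranspose_conjTranspose, show bᴴ * a * (aᴴ * b) = bᴴ * (a * aᴴ) * b by simp only [Matrix.mul_assoc], ha', Matrix.mul_one, hb]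

/-- **THE READING CHARTS AND `hfr2`.**  For the ★ FILE 2 reading frames `fr_w` on the explicit Shimura frames (matrix formula `hfrM`) there are charts
`ι_w : M(ℂ) → archLocal L (n+n) J^𝔻 w` with: (hιfr) `ι_w (k_u) = fr_w u`; the matrix formula `reindex e₂ (T_w⁻¹ P T_w)` and multiplicativity on `U(J)`; and (hfr2) every
`g ∈ archLocal w` is `p · fr_w u` with the `w`-slice of `p` in `P_Δ(𝔸)` — `T_w g̃ T_w⁻¹ = u(X) m(R) κ(a,b)` (★ tube Iwasawa + ★ chart onto `Stab(i1)`), `κ(a,b) = κ(a,a) κ(1, aᴴb)`,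
`p := ι_w (u(X) m(R) κ(a,a))` tube-Siegel (§1 ⇒ `IsSiegelM` ⇒ ★ slice criterion). [cite: Shimura1997, §§6.4–6.5] [cite: GelbartRogawski1991, §3.1] [cite: BorelJacquet1979, §4.1] -/
theorem exists_readingChart (hdV0 : ∀ i, dV i ≠ 0) (hdW0 : ∀ j, dW j ≠ 0)
    (fr : ∀ w : {w : InfinitePlace L // w.IsComplex}, Matrix.unitaryGroup (Fin n) ℂ →* archLocal L (n + n) (hermD L e dV hdV dW hdW) w)
    (hfrM : ∀ (w : {w : InfinitePlace L // w.IsComplex}) (u : Matrix.unitaryGroup (Fin n) ℂ),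
      ((((fr w u : archLocal L (n + n) (hermD L e dV hdV dW hdW) w) : GL (Fin (n + n)) ℂ)) : Matrix (Fin (n + n)) (Fin (n + n)) ℂ) =
        Matrix.reindex (e₂ (n := n)) (e₂ (n := n))
          (fromBlocks (diagonal (fun k => (((Real.sqrt (|(w.1.embedding (dV (e.symm k).1 * dW (e.symm k).2)).re| / 2))⁻¹ / 2 : ℝ) : ℂ)))
              (-diagonal (fun k => I * (((Real.sqrt (|(w.1.embedding (dV (e.symm k).1 * dW (e.symm k).2)).re| / 2))⁻¹ *
                ((w.1.embedding (dV (e.symm k).1 * dW (e.symm k).2)).re / |(w.1.embedding (dV (e.symm k).1 * dW (e.symm k).2)).re|) / 2 : ℝ) : ℂ)))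
              (diagonal (fun k => (((Real.sqrt (|(w.1.embedding (dV (e.symm k).1 * dW (e.symm k).2)).re| / 2))⁻¹ / 2 : ℝ) : ℂ)))
              (diagonal (fun k => I * (((Real.sqrt (|(w.1.embedding (dV (e.symm k).1 * dW (e.symm k).2)).re| / 2))⁻¹ *
                ((w.1.embedding (dV (e.symm k).1 * dW (e.symm k).2)).re / |(w.1.embedding (dV (e.symm k).1 * dW (e.symm k).2)).re|) / 2 : ℝ) : ℂ))) *
            ((fromBlocks 1 1 (I • 1) (-(I • 1)) : Matrix (Fin n ⊕ Fin n) (Fin n ⊕ Fin n) ℂ) * fromBlocks 1 0 0 (u : Matrix (Fin n) (Fin n) ℂ) *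
              ((2 : ℂ)⁻¹ • fromBlocks 1 (-(I • 1)) 1 (I • 1))) *
            fromBlocks (diagonal (fun k => (Real.sqrt (|(w.1.embedding (dV (e.symm k).1 * dW (e.symm k).2)).re| / 2) : ℂ)))
              (diagonal (fun k => (Real.sqrt (|(w.1.embedding (dV (e.symm k).1 * dW (e.symm k).2)).re| / 2) : ℂ)))
              (diagonal (fun k => I * ((((w.1.embedding (dV (e.symm k).1 * dW (e.symm k).2)).re / |(w.1.embedding (dV (e.symm k).1 * dW (e.symm k).2)).re|) *
                Real.sqrt (|(w.1.embedding (dV (e.symm k).1 * dW (e.symm k).2)).re| / 2) : ℝ) : ℂ)))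
              (-diagonal (fun k => I * ((((w.1.embedding (dV (e.symm k).1 * dW (e.symm k).2)).re / |(w.1.embedding (dV (e.symm k).1 * dW (e.symm k).2)).re|) *
                Real.sqrt (|(w.1.embedding (dV (e.symm k).1 * dW (e.symm k).2)).re| / 2) : ℝ) : ℂ))))) :
    ∃ ι : ∀ w : {w : InfinitePlace L // w.IsComplex}, Matrix (Fin n ⊕ Fin n) (Fin n ⊕ Fin n) ℂ → archLocal L (n + n) (hermD L e dV hdV dW hdW) w,
      (∀ (w : {w : InfinitePlace L // w.IsComplex}) (u : Matrix.unitaryGroup (Fin n) ℂ),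
        ι w ((2 : ℂ)⁻¹ • fromBlocks (1 + (u : Matrix (Fin n) (Fin n) ℂ)) (-(I • (1 - (u : Matrix (Fin n) (Fin n) ℂ)))) (I • (1 - (u : Matrix (Fin n) (Fin n) ℂ)))
          (1 + (u : Matrix (Fin n) (Fin n) ℂ)) : Matrix (Fin n ⊕ Fin n) (Fin n ⊕ Fin n) ℂ) = fr w u) ∧
      (∀ (w : {w : InfinitePlace L // w.IsComplex}) (P : Matrix (Fin n ⊕ Fin n) (Fin n ⊕ Fin n) ℂ), Pᴴ * Matrix.J (Fin n) ℂ * P = Matrix.J (Fin n) ℂ →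
        ((((ι w P : archLocal L (n + n) (hermD L e dV hdV dW hdW) w) : GL (Fin (n + n)) ℂ)) : Matrix (Fin (n + n)) (Fin (n + n)) ℂ) =
          Matrix.reindex (e₂ (n := n)) (e₂ (n := n))
            (fromBlocks (diagonal (fun k => (((Real.sqrt (|(w.1.embedding (dV (e.symm k).1 * dW (e.symm k).2)).re| / 2))⁻¹ / 2 : ℝ) : ℂ)))
              (-diagonal (fun k => I * (((Real.sqrt (|(w.1.embedding (dV (e.symm k).1 * dW (e.symm k).2)).re| / 2))⁻¹ *
                ((w.1.embedding (dV (e.symm k).1 * dW (e.symm k).2)).re / |(w.1.embedding (dV (e.symm k).1 * dW (e.symm k).2)).re|) / 2 : ℝ) : ℂ)))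
              (diagonal (fun k => (((Real.sqrt (|(w.1.embedding (dV (e.symm k).1 * dW (e.symm k).2)).re| / 2))⁻¹ / 2 : ℝ) : ℂ)))
              (diagonal (fun k => I * (((Real.sqrt (|(w.1.embedding (dV (e.symm k).1 * dW (e.symm k).2)).re| / 2))⁻¹ *
                ((w.1.embedding (dV (e.symm k).1 * dW (e.symm k).2)).re / |(w.1.embedding (dV (e.symm k).1 * dW (e.symm k).2)).re|) / 2 : ℝ) : ℂ))) * P *
              fromBlocks (diagonal (fun k => (Real.sqrt (|(w.1.embedding (dV (e.symm k).1 * dW (e.symm k).2)).re| / 2) : ℂ)))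
              (diagonal (fun k => (Real.sqrt (|(w.1.embedding (dV (e.symm k).1 * dW (e.symm k).2)).re| / 2) : ℂ)))
              (diagonal (fun k => I * ((((w.1.embedding (dV (e.symm k).1 * dW (e.symm k).2)).re / |(w.1.embedding (dV (e.symm k).1 * dW (e.symm k).2)).re|) *
                Real.sqrt (|(w.1.embedding (dV (e.symm k).1 * dW (e.symm k).2)).re| / 2) : ℝ) : ℂ)))
              (-diagonal (fun k => I * ((((w.1.embedding (dV (e.symm k).1 * dW (e.symm k).2)).re / |(w.1.embedding (dV (e.symm k).1 * dW (e.symm k).2)).re|) *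
                Real.sqrt (|(w.1.embedding (dV (e.symm k).1 * dW (e.symm k).2)).re| / 2) : ℝ) : ℂ))))) ∧
      (∀ (w : {w : InfinitePlace L // w.IsComplex}) (P Q : Matrix (Fin n ⊕ Fin n) (Fin n ⊕ Fin n) ℂ),
        Pᴴ * Matrix.J (Fin n) ℂ * P = Matrix.J (Fin n) ℂ → Qᴴ * Matrix.J (Fin n) ℂ * Q = Matrix.J (Fin n) ℂ → ι w (P * Q) = ι w P * ι w Q) ∧
      (∀ (w : {w : InfinitePlace L // w.IsComplex}) (g : archLocal L (n + n) (hermD L e dV hdV dW hdW) w),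
        ∃ p : archLocal L (n + n) (hermD L e dV hdV dW hdW) w,
          IsSiegelDelta L e dV hdV dW hdW (archToAdelic (Fp L) L (IsCMField.complexConj L) (n + n) (hermD L e dV hdV dW hdW)
            ((archPiEquivCM (n + n) L (hermD L e dV hdV dW hdW)).symm (Pi.mulSingle w p))) ∧
          ∃ u : Matrix.unitaryGroup (Fin n) ℂ, g = p * fr w u) := by
  -- per place: the explicit frame's letters and the generic chart
  have hι : ∀ w : {w : InfinitePlace L // w.IsComplex},
      ∃ ι : Matrix (Fin n ⊕ Fin n) (Fin n ⊕ Fin n) ℂ → archLocal L (n + n) (hermD L e dV hdV dW hdW) w,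
        (∀ P, Pᴴ * Matrix.J (Fin n) ℂ * P = Matrix.J (Fin n) ℂ →
          ((((ι P : archLocal L (n + n) (hermD L e dV hdV dW hdW) w) : GL (Fin (n + n)) ℂ)) : Matrix (Fin (n + n)) (Fin (n + n)) ℂ) =
            Matrix.reindex (e₂ (n := n)) (e₂ (n := n))
              (fromBlocks (diagonal (fun k => (((Real.sqrt (|(w.1.embedding (dV (e.symm k).1 * dW (e.symm k).2)).re| / 2))⁻¹ / 2 : ℝ) : ℂ)))
              (-diagonal (fun k => I * (((Real.sqrt (|(w.1.embedding (dV (e.symm k).1 * dW (e.symm k).2)).re| / 2))⁻¹ *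
                ((w.1.embedding (dV (e.symm k).1 * dW (e.symm k).2)).re / |(w.1.embedding (dV (e.symm k).1 * dW (e.symm k).2)).re|) / 2 : ℝ) : ℂ)))
              (diagonal (fun k => (((Real.sqrt (|(w.1.embedding (dV (e.symm k).1 * dW (e.symm k).2)).re| / 2))⁻¹ / 2 : ℝ) : ℂ)))
              (diagonal (fun k => I * (((Real.sqrt (|(w.1.embedding (dV (e.symm k).1 * dW (e.symm k).2)).re| / 2))⁻¹ *
                ((w.1.embedding (dV (e.symm k).1 * dW (e.symm k).2)).re / |(w.1.embedding (dV (e.symm k).1 * dW (e.symm k).2)).re|) / 2 : ℝ) : ℂ))) * P *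
                fromBlocks (diagonal (fun k => (Real.sqrt (|(w.1.embedding (dV (e.symm k).1 * dW (e.symm k).2)).re| / 2) : ℂ)))
              (diagonal (fun k => (Real.sqrt (|(w.1.embedding (dV (e.symm k).1 * dW (e.symm k).2)).re| / 2) : ℂ)))
              (diagonal (fun k => I * ((((w.1.embedding (dV (e.symm k).1 * dW (e.symm k).2)).re / |(w.1.embedding (dV (e.symm k).1 * dW (e.symm k).2)).re|) *
                Real.sqrt (|(w.1.embedding (dV (e.symm k).1 * dW (e.symm k).2)).re| / 2) : ℝ) : ℂ)))
              (-diagonal (fun k => I * ((((w.1.embedding (dV (e.symm k).1 * dW (e.symm k).2)).re / |(w.1.embedding (dV (e.symm k).1 * dW (e.symm k).2)).re|) *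
                Real.sqrt (|(w.1.embedding (dV (e.symm k).1 * dW (e.symm k).2)).re| / 2) : ℝ) : ℂ))))) ∧
        (∀ P Q, Pᴴ * Matrix.J (Fin n) ℂ * P = Matrix.J (Fin n) ℂ → Qᴴ * Matrix.J (Fin n) ℂ * Q = Matrix.J (Fin n) ℂ → ι (P * Q) = ι P * ι Q) := by
    intro w
    have hw : IsCMField.complexConj L • w.1 = w.1 := complexConj_smul_infinitePlace L w.1
    have ht := tw_ne_zero L e dV hdV dW hdW w hw hdV0 hdW0
    have hd : ∀ i, Real.sqrt (|(w.1.embedding (dV (e.symm i).1 * dW (e.symm i).2)).re| / 2) ≠ 0 := fun i => (letters_of _ ht i).1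
    have he : ∀ i, (w.1.embedding (dV (e.symm i).1 * dW (e.symm i).2)).re / |(w.1.embedding (dV (e.symm i).1 * dW (e.symm i).2)).re| *
        ((w.1.embedding (dV (e.symm i).1 * dW (e.symm i).2)).re / |(w.1.embedding (dV (e.symm i).1 * dW (e.symm i).2)).re|) = 1 :=
      fun i => (letters_of _ ht i).2.1
    have ht' := fun i => (letters_of _ ht i).2.2
    exact exists_frameChart (frame_mul_frameInv (letters_R1 _ hd) (letters_R2 _ _ hd he)) (frameInv_mul_frame (letters_R3 _ _ hd he) (letters_R4 _ _ hd he))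
      (frame_conjTranspose_mul_smul_J_mul _ _ _ ht') _ (mem_archLocal_hermD_iff L e dV hdV dW hdW w hw)
  choose ι hιM hιmul using hι
  -- (hιfr): the chart matches the frames at `k_u = κ(1,u)`
  have hιfr : ∀ (w : {w : InfinitePlace L // w.IsComplex}) (u : Matrix.unitaryGroup (Fin n) ℂ),
      ι w ((2 : ℂ)⁻¹ • fromBlocks (1 + (u : Matrix (Fin n) (Fin n) ℂ)) (-(I • (1 - (u : Matrix (Fin n) (Fin n) ℂ)))) (I • (1 - (u : Matrix (Fin n) (Fin n) ℂ)))
        (1 + (u : Matrix (Fin n) (Fin n) ℂ)) : Matrix (Fin n ⊕ Fin n) (Fin n ⊕ Fin n) ℂ) = fr w u := by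
    intro w u
    have hu : (u : Matrix (Fin n) (Fin n) ℂ)ᴴ * (u : Matrix (Fin n) (Fin n) ℂ) = 1 := by
      rw [← star_eq_conjTranspose]; exact Matrix.mem_unitaryGroup_iff'.1 u.2
    apply Subtype.ext; apply Units.ext
    rw [hιM w _ (kU_mem_UJ hu), hfrM, ← cayley_diag_one_eq]
  refine ⟨ι, hιfr, hιM, hιmul, fun w g => ?_⟩
  -- (hfr2): the Iwasawa decomposition relative to the frame
  have hw : IsCMField.complexConj L • w.1 = w.1 := complexConj_smul_infinitePlace L w.1
  have ht := tw_ne_zero L e dV hdV dW hdW w hw hdV0 hdW0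
  have hd : ∀ i, Real.sqrt (|(w.1.embedding (dV (e.symm i).1 * dW (e.symm i).2)).re| / 2) ≠ 0 := fun i => (letters_of _ ht i).1
  have he : ∀ i, (w.1.embedding (dV (e.symm i).1 * dW (e.symm i).2)).re / |(w.1.embedding (dV (e.symm i).1 * dW (e.symm i).2)).re| *
      ((w.1.embedding (dV (e.symm i).1 * dW (e.symm i).2)).re / |(w.1.embedding (dV (e.symm i).1 * dW (e.symm i).2)).re|) = 1 :=
    fun i => (letters_of _ ht i).2.1
  have ht' := fun i => (letters_of _ ht i).2.2
  have h1 := frame_mul_frameInv (letters_R1 _ hd) (letters_R2 (fun i => Real.sqrt (|(w.1.embedding (dV (e.symm i).1 * dW (e.symm i).2)).re| / 2)) _ hd he)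
  have h2 := frameInv_mul_frame (letters_R3 (fun i => Real.sqrt (|(w.1.embedding (dV (e.symm i).1 * dW (e.symm i).2)).re| / 2)) _ hd he)
    (letters_R4 _ _ hd he)
  have hT := frame_conjTranspose_mul_smul_J_mul (fun i => Real.sqrt (|(w.1.embedding (dV (e.symm i).1 * dW (e.symm i).2)).re| / 2)) _ _ ht'
  -- the tube image `P = T g̃ T⁻¹ ∈ U(J)` and its Iwasawa factorisation `P = u(X) m(R) s`, `s ∈ Stab(i1)`, `s = κ(a,b)`
  have hg := (mem_archLocal_hermD_iff L e dV hdV dW hdW w hw (g : GL (Fin (n + n)) ℂ)).1 g.2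
  have hP := conj_mem_UJ hT h1 hg
  obtain ⟨X, R, s, hX, hR, hRu, hs, hsI, hPeq⟩ := exists_transl_levi_mul_stabilizer hP
  obtain ⟨ha, hb, hseq⟩ := exists_kappa_eq_of_stab hs hsI
  obtain ⟨ha', hu⟩ := conjTranspose_mul_aux ha hb
  have hlevi : (fromBlocks R 0 0 R⁻¹ : Matrix (Fin n ⊕ Fin n) (Fin n ⊕ Fin n) ℂ)ᴴ * Matrix.J (Fin n) ℂ * fromBlocks R 0 0 R⁻¹ = Matrix.J (Fin n) ℂ := by
    rw [levi_mem_iff, hR, mul_nonsing_inv R hRu]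
  have htransl : (fromBlocks 1 X 0 1 : Matrix (Fin n ⊕ Fin n) (Fin n ⊕ Fin n) ℂ)ᴴ * Matrix.J (Fin n) ℂ * fromBlocks 1 X 0 1 = Matrix.J (Fin n) ℂ := by
    rw [transl_mem_iff, hX]
  have hκaa := kappa_mem_UJ ha ha
  have hκ1 := kappa_mem_UJ (l := Fin n) (k₁ := 1) (by rw [conjTranspose_one, Matrix.one_mul]) hu
  have hp₀ := mul_mem_UJ (mul_mem_UJ htransl hlevi) hκaa
  -- `κ(a,b) = κ(a,a) κ(1, aᴴ b)`
  have hsplit : s = (fromBlocks 1 1 (I • 1) (-(I • 1)) : Matrix (Fin n ⊕ Fin n) (Fin n ⊕ Fin n) ℂ) *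
        fromBlocks (s.toBlocks₁₁ + I • s.toBlocks₁₂) 0 0 (s.toBlocks₁₁ + I • s.toBlocks₁₂) * ((2 : ℂ)⁻¹ • fromBlocks 1 (-(I • 1)) 1 (I • 1)) *
      ((fromBlocks 1 1 (I • 1) (-(I • 1)) : Matrix (Fin n ⊕ Fin n) (Fin n ⊕ Fin n) ℂ) *
        fromBlocks 1 0 0 ((s.toBlocks₁₁ + I • s.toBlocks₁₂)ᴴ * (s.toBlocks₁₁ - I • s.toBlocks₁₂)) * ((2 : ℂ)⁻¹ • fromBlocks 1 (-(I • 1)) 1 (I • 1))) := by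
    rw [kappa_mul, Matrix.mul_one, ← Matrix.mul_assoc, ha', Matrix.one_mul]
    exact hseq
  refine ⟨ι w (fromBlocks 1 X 0 1 * fromBlocks R 0 0 R⁻¹ * ((fromBlocks 1 1 (I • 1) (-(I • 1)) : Matrix (Fin n ⊕ Fin n) (Fin n ⊕ Fin n) ℂ) *
      fromBlocks (s.toBlocks₁₁ + I • s.toBlocks₁₂) 0 0 (s.toBlocks₁₁ + I • s.toBlocks₁₂) * ((2 : ℂ)⁻¹ • fromBlocks 1 (-(I • 1)) 1 (I • 1)))), ?_,
    ⟨⟨(s.toBlocks₁₁ + I • s.toBlocks₁₂)ᴴ * (s.toBlocks₁₁ - I • s.toBlocks₁₂), Matrix.mem_unitaryGroup_iff'.2 (by rw [star_eq_conjTranspose]; exact hu)⟩, ?_⟩⟩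
  · -- its slice is in `P_Δ(𝔸)`: `IsSiegelM (reindex e₂ (T⁻¹ p₀ T))` by §1 (`(p₀)₂₁ = 0`)
    rw [isSiegelDelta_archPiEquivCM_symm_mulSingle_iff, hιM w _ hp₀]
    have h21 : (fromBlocks 1 X 0 1 * fromBlocks R 0 0 R⁻¹ * ((fromBlocks 1 1 (I • 1) (-(I • 1)) : Matrix (Fin n ⊕ Fin n) (Fin n ⊕ Fin n) ℂ) *
        fromBlocks (s.toBlocks₁₁ + I • s.toBlocks₁₂) 0 0 (s.toBlocks₁₁ + I • s.toBlocks₁₂) * ((2 : ℂ)⁻¹ • fromBlocks 1 (-(I • 1)) 1 (I • 1)))).toBlocks₂₁ = 0 := by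
      rw [kappa_self, transl_mul_levi_eq, fromBlocks_multiply, toBlocks_fromBlocks₂₁, Matrix.zero_mul, Matrix.mul_zero, add_zero]
    unfold IsSiegelM
    rw [reindex_symm_reindex]
    exact siegel_of_toBlocks₂₁_eq_zero _ _ _ _ h21
  · -- `g = p · fr_w (aᴴ b)`: both sides have the same tube image
    rw [← hιfr]
    change g = ι w _ * ι w ((2 : ℂ)⁻¹ • fromBlocks (1 + (s.toBlocks₁₁ + I • s.toBlocks₁₂)ᴴ * (s.toBlocks₁₁ - I • s.toBlocks₁₂))
      (-(I • (1 - (s.toBlocks₁₁ + I • s.toBlocks₁₂)ᴴ * (s.toBlocks₁₁ - I • s.toBlocks₁₂)))) (I • (1 - (s.toBlocks₁₁ + I • s.toBlocks₁₂)ᴴ * (s.toBlocks₁₁ - I • s.toBlocks₁₂)))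
      (1 + (s.toBlocks₁₁ + I • s.toBlocks₁₂)ᴴ * (s.toBlocks₁₁ - I • s.toBlocks₁₂)))
    rw [← cayley_diag_one_eq, ← hιmul w _ _ hp₀ hκ1]
    apply Subtype.ext; apply Units.ext
    rw [show fromBlocks 1 X 0 1 * fromBlocks R 0 0 R⁻¹ * ((fromBlocks 1 1 (I • 1) (-(I • 1)) : Matrix (Fin n ⊕ Fin n) (Fin n ⊕ Fin n) ℂ) *
        fromBlocks (s.toBlocks₁₁ + I • s.toBlocks₁₂) 0 0 (s.toBlocks₁₁ + I • s.toBlocks₁₂) * ((2 : ℂ)⁻¹ • fromBlocks 1 (-(I • 1)) 1 (I • 1))) *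
        ((fromBlocks 1 1 (I • 1) (-(I • 1)) : Matrix (Fin n ⊕ Fin n) (Fin n ⊕ Fin n) ℂ) *
          fromBlocks 1 0 0 ((s.toBlocks₁₁ + I • s.toBlocks₁₂)ᴴ * (s.toBlocks₁₁ - I • s.toBlocks₁₂)) * ((2 : ℂ)⁻¹ • fromBlocks 1 (-(I • 1)) 1 (I • 1))) =
        fromBlocks 1 X 0 1 * fromBlocks R 0 0 R⁻¹ * s by rw [Matrix.mul_assoc, ← hsplit], ← hPeq, hιM w _ hP]
    rw [show fromBlocks (diagonal (fun k => (((Real.sqrt (|(w.1.embedding (dV (e.symm k).1 * dW (e.symm k).2)).re| / 2))⁻¹ / 2 : ℝ) : ℂ)))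
        (-diagonal (fun k => I * (((Real.sqrt (|(w.1.embedding (dV (e.symm k).1 * dW (e.symm k).2)).re| / 2))⁻¹ *
          ((w.1.embedding (dV (e.symm k).1 * dW (e.symm k).2)).re / |(w.1.embedding (dV (e.symm k).1 * dW (e.symm k).2)).re|) / 2 : ℝ) : ℂ)))
        (diagonal (fun k => (((Real.sqrt (|(w.1.embedding (dV (e.symm k).1 * dW (e.symm k).2)).re| / 2))⁻¹ / 2 : ℝ) : ℂ)))
        (diagonal (fun k => I * (((Real.sqrt (|(w.1.embedding (dV (e.symm k).1 * dW (e.symm k).2)).re| / 2))⁻¹ *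
          ((w.1.embedding (dV (e.symm k).1 * dW (e.symm k).2)).re / |(w.1.embedding (dV (e.symm k).1 * dW (e.symm k).2)).re|) / 2 : ℝ) : ℂ))) *
        (fromBlocks (diagonal (fun k => (Real.sqrt (|(w.1.embedding (dV (e.symm k).1 * dW (e.symm k).2)).re| / 2) : ℂ)))
        (diagonal (fun k => (Real.sqrt (|(w.1.embedding (dV (e.symm k).1 * dW (e.symm k).2)).re| / 2) : ℂ)))
        (diagonal (fun k => I * ((((w.1.embedding (dV (e.symm k).1 * dW (e.symm k).2)).re / |(w.1.embedding (dV (e.symm k).1 * dW (e.symm k).2)).re|) *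
          Real.sqrt (|(w.1.embedding (dV (e.symm k).1 * dW (e.symm k).2)).re| / 2) : ℝ) : ℂ)))
        (-diagonal (fun k => I * ((((w.1.embedding (dV (e.symm k).1 * dW (e.symm k).2)).re / |(w.1.embedding (dV (e.symm k).1 * dW (e.symm k).2)).re|) *
          Real.sqrt (|(w.1.embedding (dV (e.symm k).1 * dW (e.symm k).2)).re| / 2) : ℝ) : ℂ))) *
          Matrix.reindex (e₂ (n := n)).symm (e₂ (n := n)).symm ((g : GL (Fin (n + n)) ℂ) : Matrix (Fin (n + n)) (Fin (n + n)) ℂ) *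
          fromBlocks (diagonal (fun k => (((Real.sqrt (|(w.1.embedding (dV (e.symm k).1 * dW (e.symm k).2)).re| / 2))⁻¹ / 2 : ℝ) : ℂ)))
        (-diagonal (fun k => I * (((Real.sqrt (|(w.1.embedding (dV (e.symm k).1 * dW (e.symm k).2)).re| / 2))⁻¹ *
          ((w.1.embedding (dV (e.symm k).1 * dW (e.symm k).2)).re / |(w.1.embedding (dV (e.symm k).1 * dW (e.symm k).2)).re|) / 2 : ℝ) : ℂ)))
        (diagonal (fun k => (((Real.sqrt (|(w.1.embedding (dV (e.symm k).1 * dW (e.symm k).2)).re| / 2))⁻¹ / 2 : ℝ) : ℂ)))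
        (diagonal (fun k => I * (((Real.sqrt (|(w.1.embedding (dV (e.symm k).1 * dW (e.symm k).2)).re| / 2))⁻¹ *
          ((w.1.embedding (dV (e.symm k).1 * dW (e.symm k).2)).re / |(w.1.embedding (dV (e.symm k).1 * dW (e.symm k).2)).re|) / 2 : ℝ) : ℂ)))) *
        fromBlocks (diagonal (fun k => (Real.sqrt (|(w.1.embedding (dV (e.symm k).1 * dW (e.symm k).2)).re| / 2) : ℂ)))
        (diagonal (fun k => (Real.sqrt (|(w.1.embedding (dV (e.symm k).1 * dW (e.symm k).2)).re| / 2) : ℂ)))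
        (diagonal (fun k => I * ((((w.1.embedding (dV (e.symm k).1 * dW (e.symm k).2)).re / |(w.1.embedding (dV (e.symm k).1 * dW (e.symm k).2)).re|) *
          Real.sqrt (|(w.1.embedding (dV (e.symm k).1 * dW (e.symm k).2)).re| / 2) : ℝ) : ℂ)))
        (-diagonal (fun k => I * ((((w.1.embedding (dV (e.symm k).1 * dW (e.symm k).2)).re / |(w.1.embedding (dV (e.symm k).1 * dW (e.symm k).2)).re|) *
          Real.sqrt (|(w.1.embedding (dV (e.symm k).1 * dW (e.symm k).2)).re| / 2) : ℝ) : ℂ))) =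
        Matrix.reindex (e₂ (n := n)).symm (e₂ (n := n)).symm ((g : GL (Fin (n + n)) ℂ) : Matrix (Fin (n + n)) (Fin (n + n)) ℂ) by
      rw [show ∀ A B C D E : Matrix (Fin n ⊕ Fin n) (Fin n ⊕ Fin n) ℂ, A * (B * C * D) * E = (A * B) * C * (D * E) from fun A B C D E => by
        simp only [Matrix.mul_assoc], h2, Matrix.one_mul, Matrix.mul_one]]
    rw [reindex_apply, reindex_apply, submatrix_submatrix, Equiv.symm_symm, Equiv.self_comp_symm, submatrix_id_id]

end CM

end Summit.HodgeConjecture.HodgeConjecture.Cruxes.HLiu418.K2LiuArchReadingChart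

end
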